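import Summits.AtomisticToContinuum.BoseEinsteinCondensation.Theorems.BECRichardsonGaudinRichardsonAnchorBECBornPolyNorms
import HarnessLib

/-!
# Crux `RichardsonAnchorBEC` (stmt-AtomisticToContinuum-14805), route `BECRichardsonGaudin`, line `registered` —
# stub `stub_bornPolyPair`, auxiliary file: the band pair annihilator on the Born trial polynomial

Registered auxiliary stub `stub_bornPolyPairCoeff` (step (2) of the paper proof of `stub_bornPolyPair`): for the
Born trial polynomial `A = Σ_{j ≤ J₁} Σ_{S ⊆ W₊, |S|=j} λ_j θ^S X^{d_S}` (`bornTrialPoly`) and the band pair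
annihilator `Q = Σ_{p ∈ B_M} ∂_{−p}∂_p`, the coefficient of `Q A` at the index `E_T = pairIndex M (N−2) T` of a
sector `T ⊆ W₊`, `|T| = j ≤ J₁`, is `λ_j θ^T (N−2j)(N−2j−1)(1 − [j<J₁]·2c Σ_{m ∈ W₊∖T} θ_m)` — the condensate
term `∂₀²X^{d_T}` interferes with the pair terms `∂_{∓m}∂_{±m} X^{d_{T∪m}}`, `λ_{j+1} = −c(N−2j)(N−2j−1)λ_j`.
Tools: evaluation of `pairIndex` at band modes (`bornPair_pairIndex_apply*`), injectivity in the sector,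
the splitting of band sums along `{0} ∪ W₊ ∪ (−W₊)`, `MvPolynomial.coeff_pderiv`. [folklore]
-/

noncomputable section

open MeasureTheory Filter
open scoped ENNReal NNReal ComplexConjugate BigOperators

namespace Summit.AtomisticToContinuum.BoseEinsteinCondensation.Cruxes.RichardsonAnchorBEC.Birth

open Literature.MathematicalPhysics.QuantumManyBody.BoseGas
open MvPolynomial

/-- `m ∈ W₊` is non-zero, `±m` lie in the band, and `−m ∉ W₊` (lex-positivity flips under `m ↦ −m`). [folklore] -/
theorem bornPair_mem_pairReps {M R : ℕ} {m : Momentum} (hm : m ∈ pairReps M R) :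
    m ≠ 0 ∧ m ∈ momentumBand M ∧ -m ∈ momentumBand M ∧ -m ∉ pairReps M R := by
  simp only [pairReps, Finset.mem_filter] at hm
  have hB : m ∈ momentumBand M := (Finset.mem_sdiff.1 hm.1).1
  have hlex := hm.2
  refine ⟨?_, hB, neg_mem_momentumBand hB, fun h => ?_⟩
  · rintro rfl
    simp [lexPos] at hlex
  · simp only [pairReps, Finset.mem_filter] at h
    have hlex' := h.2
    simp only [lexPos, Pi.neg_apply] at hlex hlex'
    omega

/-- Every band mode is `toBand` of its value. [folklore] -/
theorem bornPair_toBand_coe {M : ℕ} (p : ↥(momentumBand M)) : toBand M p.1 = p :=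
  Subtype.ext (toBand_val p.2)

/-- `toBand` is injective on the band. [folklore] -/
theorem bornPair_toBand_inj {M : ℕ} {k k' : Momentum} (hk : k ∈ momentumBand M)
    (hk' : k' ∈ momentumBand M) : toBand M k = toBand M k' ↔ k = k' := by
  refine ⟨fun h => ?_, fun h => by rw [h]⟩
  have h' := congrArg Subtype.val h
  rwa [toBand_val hk, toBand_val hk'] at h'

/-- Time reversal commutes with `toBand` on the band. [folklore] -/
theorem bornPair_neg_toBand {M : ℕ} {k : Momentum} (hk : k ∈ momentumBand M) :
    -toBand M k = toBand M (-k) :=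
  Subtype.ext (by rw [neg_bandMode_val, toBand_val hk, toBand_val (neg_mem_momentumBand hk)])

/-- A sum over the band modes is a sum over the band. [folklore] -/
theorem bornPair_sum_band {α : Type*} [AddCommMonoid α] {M : ℕ} (F : ↥(momentumBand M) → α) :
    ∑ p, F p = ∑ k ∈ momentumBand M, F (toBand M k) := by
  rw [← Finset.sum_coe_sort (momentumBand M) (fun k => F (toBand M k))]
  exact Fintype.sum_congr _ _ fun p => by rw [bornPair_toBand_coe]

/-- Evaluation of a unit vector of the band at a band mode. [folklore] -/
theorem bornPair_single_apply {M : ℕ} {k k' : Momentum} (hk : k ∈ momentumBand M)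
    (hk' : k' ∈ momentumBand M) (n : ℕ) :
    Finsupp.single (toBand M k) n (toBand M k') = if k = k' then n else 0 := by
  classical
  rw [Finsupp.single_apply]
  by_cases h : k = k'
  · rw [if_pos h, if_pos (by rw [h])]
  · rw [if_neg h, if_neg (mt (bornPair_toBand_inj hk hk').1 h)]

/-- `pairIndex M N S` at the band mode `k`: `N − 2|S|` at `k = 0`, `[k ∈ S] + [−k ∈ S]` elsewhere
(`BornPolyNorms.pairIndex_apply` at `toBand M k`). [folklore] -/
theorem bornPair_pairIndex_apply {M R N : ℕ} {S : Finset Momentum} (hS : S ⊆ pairReps M R)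
    {k : Momentum} (hk : k ∈ momentumBand M) :
    pairIndex M N S (toBand M k) =
      (if (0 : Momentum) = k then N - 2 * S.card else 0) +
        ((if k ∈ S then 1 else 0) + if -k ∈ S then 1 else 0) := by
  rw [BornPolyNorms.pairIndex_apply hS, toBand_val hk]

/-- At `−m`, `m ∈ W₊`, the sector `S` has occupation `[m ∈ S]`. [folklore] -/
theorem bornPair_pairIndex_apply_neg {M R N : ℕ} {S : Finset Momentum} (hS : S ⊆ pairReps M R)
    {m : Momentum} (hm : m ∈ pairReps M R) :
    pairIndex M N S (toBand M (-m)) = if m ∈ S then 1 else 0 := by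
  obtain ⟨hm0, -, hmB, hmn⟩ := bornPair_mem_pairReps hm
  rw [bornPair_pairIndex_apply hS hmB, if_neg fun h => hm0 (neg_eq_zero.1 h.symm), zero_add,
    neg_neg, if_neg (fun h => hmn (hS h)), zero_add]

/-- Off the zero mode and off `±W₊` the sector `S` has occupation `0`. [folklore] -/
theorem bornPair_pairIndex_apply_off {M R N : ℕ} {S : Finset Momentum} (hS : S ⊆ pairReps M R)
    {k : Momentum} (hk : k ∈ momentumBand M) (hk0 : k ≠ 0) (hk1 : k ∉ pairReps M R)
    (hk2 : -k ∉ pairReps M R) : pairIndex M N S (toBand M k) = 0 := by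
  rw [bornPair_pairIndex_apply hS hk, if_neg (Ne.symm hk0), if_neg (fun h => hk1 (hS h)),
    if_neg (fun h => hk2 (hS h))]

/-- A band sum of a function vanishing off `{0} ∪ ±U`, `U ⊆ W₊`, splits along `0` and `±m`. [folklore] -/
theorem bornPair_sum_band_split {α : Type*} [AddCommMonoid α] {M R : ℕ} {U : Finset Momentum}
    (hU : U ⊆ pairReps M R) (f : Momentum → α)
    (hf : ∀ k ∈ momentumBand M, k ≠ 0 → k ∉ U → -k ∉ U → f k = 0) :
    ∑ k ∈ momentumBand M, f k = f 0 + ∑ m ∈ U, (f m + f (-m)) := by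
  classical
  have hUB : ∀ m ∈ U, m ≠ 0 ∧ m ∈ momentumBand M ∧ -m ∈ momentumBand M ∧ -m ∉ U :=
    fun m hm =>
    have h := bornPair_mem_pairReps (hU hm)
    ⟨h.1, h.2.1, h.2.2.1, fun h' => h.2.2.2 (hU h')⟩
  have h0U : (0 : Momentum) ∉ U ∪ U.image Neg.neg := by
    rw [Finset.mem_union, Finset.mem_image, not_or, not_exists]
    exact ⟨fun h => (hUB 0 h).1 rfl, fun m ⟨hm, hm0⟩ => (hUB m hm).1 (neg_eq_zero.1 hm0)⟩
  have hdisj : Disjoint U (U.image Neg.neg) := by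
    rw [Finset.disjoint_left]
    rintro k hk hk'
    obtain ⟨m, hm, rfl⟩ := Finset.mem_image.1 hk'
    exact (hUB m hm).2.2.2 hk
  have hsub : insert 0 (U ∪ U.image Neg.neg) ⊆ momentumBand M :=
    Finset.insert_subset (zero_mem_momentumBand M) (Finset.union_subset
      (fun m hm => (hUB m hm).2.1) (Finset.image_subset_iff.2 fun m hm => (hUB m hm).2.2.1))
  rw [← Finset.sum_subset hsub fun k hk hkV => ?_, Finset.sum_insert h0U, Finset.sum_union hdisj,
    Finset.sum_image neg_injective.injOn, ← Finset.sum_add_distrib]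
  rw [Finset.mem_insert, Finset.mem_union, Finset.mem_image, not_or, not_or, not_exists] at hkV
  exact hf k hk hkV.1 hkV.2.1 fun h => hkV.2.2 (-k) ⟨h, neg_neg k⟩

/-- `E_T + 2e_0 = d_T`: two more condensate particles on the sector `T` at `N − 2`. [folklore] -/
theorem bornPair_pairIndex_add_two {M N : ℕ} {T : Finset Momentum} (hN : 2 * T.card + 2 ≤ N) :
    pairIndex M (N - 2) T + Finsupp.single (toBand M 0) 1 + Finsupp.single (toBand M 0) 1 =
      pairIndex M N T := by
  unfold pairIndex
  rw [show N - 2 * T.card = N - 2 - 2 * T.card + 1 + 1 by omega, Finsupp.single_add,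
    Finsupp.single_add]
  abel

/-- Adding the pair `±m`, `m ∉ T`, to the sector `T` at particle number `N − 2` gives the sector
`T ∪ {m}` at particle number `N` — the second-Born interference of the pair sectors. [folklore] -/
theorem bornPair_pairIndex_insert {M N : ℕ} {T : Finset Momentum} {m : Momentum} (hm : m ∉ T) :
    pairIndex M (N - 2) T + Finsupp.single (toBand M (-m)) 1 + Finsupp.single (toBand M m) 1 =
      pairIndex M N (insert m T) := by
  classical
  unfold pairIndex
  rw [Finset.sum_insert hm, Finset.card_insert_of_notMem hm,
    show N - 2 - 2 * T.card = N - 2 * (T.card + 1) by omega]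
  abel

/-- The coefficients of the Born trial polynomial. [folklore] -/
theorem bornPair_coeff_bornTrialPoly (γ L : ℝ) (M R N J₁ : ℕ) (e : ↥(momentumBand M) →₀ ℕ) :
    coeff e (bornTrialPoly γ L M R N J₁) =
      ∑ j ∈ Finset.range (J₁ + 1), ∑ S ∈ (pairReps M R).powersetCard j,
        if pairIndex M N S = e then
          (((bornCoeff γ L M R N j * ∏ m ∈ S, modeWeight L m : ℝ)) : ℂ) else 0 := by
  classical
  simp only [bornTrialPoly, coeff_sum, coeff_monomial]

/-- The coefficient of `A` at the sector `T ⊆ W₊`: `λ_{|T|} θ^T` (zero beyond the window). [folklore] -/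
theorem bornPair_coeff_bornTrialPoly_pairIndex (γ L : ℝ) {M R : ℕ} (N J₁ : ℕ)
    {T : Finset Momentum} (hT : T ⊆ pairReps M R) :
    coeff (pairIndex M N T) (bornTrialPoly γ L M R N J₁) =
      if T.card ≤ J₁ then (((bornCoeff γ L M R N T.card * ∏ m ∈ T, modeWeight L m : ℝ)) : ℂ)
      else 0 := by
  classical
  rw [bornPair_coeff_bornTrialPoly]
  have hzero : ∀ j, ∀ S ∈ (pairReps M R).powersetCard j, S ≠ T →
      (if pairIndex M N S = pairIndex M N T then
        (((bornCoeff γ L M R N j * ∏ m ∈ S, modeWeight L m : ℝ)) : ℂ) else 0) = 0 :=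
    fun j S hS hST => if_neg fun h => hST (BornPolyNorms.pairIndex_injective (Finset.mem_powersetCard.1 hS).1 hT h)
  have hcard : ∀ j, ∀ S ∈ (pairReps M R).powersetCard j, j ≠ T.card → S ≠ T :=
    fun j S hS hj hST => hj ((Finset.mem_powersetCard.1 hS).2.symm.trans (by rw [hST]))
  split_ifs with hTJ
  · rw [Finset.sum_eq_single_of_mem T.card (Finset.mem_range.2 (Nat.lt_succ_of_le hTJ))
        fun j _ hj => Finset.sum_eq_zero fun S hS => hzero j S hS (hcard j S hS hj),
      Finset.sum_eq_single_of_mem T (Finset.mem_powersetCard.2 ⟨hT, rfl⟩)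
        fun S hS hST => hzero _ S hS hST, if_pos rfl]
  · exact Finset.sum_eq_zero fun j hj => Finset.sum_eq_zero fun S hS => hzero j S hS
      (hcard j S hS fun h => hTJ (h ▸ Nat.lt_succ_iff.1 (Finset.mem_range.1 hj)))

/-- A multi-index which is not the index of a sector in `W₊` carries no amplitude. [folklore] -/
theorem bornPair_coeff_bornTrialPoly_eq_zero (γ L : ℝ) {M R : ℕ} (N J₁ : ℕ)
    {e : ↥(momentumBand M) →₀ ℕ} (he : ∀ S ⊆ pairReps M R, pairIndex M N S ≠ e) :
    coeff e (bornTrialPoly γ L M R N J₁) = 0 := by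
  classical
  rw [bornPair_coeff_bornTrialPoly]
  refine Finset.sum_eq_zero fun j _ => Finset.sum_eq_zero fun S hS => if_neg ?_
  exact he S (Finset.mem_powersetCard.1 hS).1

/-- The ratio of consecutive pair-number amplitudes: `λ_{j+1} = −c (N−2j)(N−2j−1) λ_j`. [folklore] -/
theorem bornPair_bornCoeff_succ (γ L : ℝ) (M R : ℕ) {N j : ℕ} (h : 2 * j + 2 ≤ N) :
    bornCoeff γ L M R N (j + 1) =
      -bornCoupling γ L M R * (((N : ℝ) - 2 * j) * ((N : ℝ) - 2 * j - 1)) *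
        bornCoeff γ L M R N j := by
  unfold bornCoeff
  rw [show 2 * (j + 1) = 2 * j + 1 + 1 by ring, Nat.descFactorial_succ, Nat.descFactorial_succ,
    pow_succ, Nat.cast_mul, Nat.cast_mul, Nat.cast_sub (by omega), Nat.cast_sub (by omega)]
  push_cast
  ring

/-- The coefficients of `Q A = Σ_{p ∈ B_M} ∂_{−p}∂_p A` (the band pair annihilator) in terms of the
coefficients of `A`. [folklore] -/
theorem bornPair_coeff_pairAn_sum {M : ℕ} (A : MvPolynomial ↥(momentumBand M) ℂ)
    (E : ↥(momentumBand M) →₀ ℕ) :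
    coeff E (∑ p : ↥(momentumBand M), pderiv (-p) (pderiv p A)) =
      ∑ k ∈ momentumBand M,
        coeff (E + Finsupp.single (toBand M (-k)) 1 + Finsupp.single (toBand M k) 1) A *
          (((E (toBand M k) + Finsupp.single (toBand M (-k)) 1 (toBand M k) + 1) *
            (E (toBand M (-k)) + 1) : ℕ) : ℂ) := by
  rw [coeff_sum, bornPair_sum_band]
  refine Finset.sum_congr rfl fun k hk => ?_
  rw [coeff_pderiv, coeff_pderiv, bornPair_neg_toBand hk, Finsupp.add_apply]
  push_cast
  ring

/-- Off `{0} ∪ ±(W₊ ∖ T)` the shifted sector index `E_T + e_{−k} + e_k` is not a sector index, so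
the corresponding coefficient of the trial polynomial vanishes. [folklore] -/
theorem bornPair_coeff_shift_eq_zero (γ L : ℝ) {M R : ℕ} (N J₁ : ℕ) {T : Finset Momentum}
    (hT : T ⊆ pairReps M R) {k : Momentum} (hk : k ∈ momentumBand M) (hk0 : k ≠ 0)
    (hkU : k ∉ pairReps M R \ T) (hkU' : -k ∉ pairReps M R \ T) :
    coeff (pairIndex M (N - 2) T + Finsupp.single (toBand M (-k)) 1 +
        Finsupp.single (toBand M k) 1) (bornTrialPoly γ L M R N J₁) = 0 := by
  classical
  refine bornPair_coeff_bornTrialPoly_eq_zero γ L N J₁ fun S hS heq => ?_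
  have h := DFunLike.congr_fun heq (toBand M k)
  simp only [Finsupp.add_apply, bornPair_single_apply (neg_mem_momentumBand hk) hk,
    bornPair_single_apply hk hk] at h
  rw [Finset.mem_sdiff, not_and, not_not] at hkU hkU'
  by_cases hkW : k ∈ pairReps M R
  · rw [BornPolyNorms.pairIndex_apply_rep hS hkW, BornPolyNorms.pairIndex_apply_rep hT hkW,
      if_pos (hkU hkW)] at h
    split_ifs at h <;> omega
  · by_cases hkW' : -k ∈ pairReps M R
    · have e1 := bornPair_pairIndex_apply_neg (N := N) hS hkW'
      have e2 := bornPair_pairIndex_apply_neg (N := N - 2) hT hkW'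
      rw [neg_neg] at e1 e2
      rw [e1, e2, if_pos (hkU' hkW')] at h
      split_ifs at h <;> omega
    · rw [bornPair_pairIndex_apply_off hS hk hk0 hkW hkW',
        bornPair_pairIndex_apply_off hT hk hk0 hkW hkW'] at h
      exact absurd h.symm (Nat.add_one_ne_zero _)

/-- The amplitude of the sector `T ∪ {m}`, `m ∈ W₊ ∖ T`, seen from `T`: `λ_{|T|+1} θ_m θ^T` inside the
pair-number window, `0` beyond it. [folklore] -/
theorem bornPair_coeff_insert (γ L : ℝ) {M R : ℕ} (N J₁ : ℕ) {T : Finset Momentum}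
    (hT : T ⊆ pairReps M R) {m : Momentum} (hm : m ∈ pairReps M R \ T) :
    coeff (pairIndex M N (insert m T)) (bornTrialPoly γ L M R N J₁) =
      if T.card < J₁ then
        (((bornCoeff γ L M R N (T.card + 1) * (modeWeight L m * ∏ m' ∈ T, modeWeight L m') : ℝ))
          : ℂ) else 0 := by
  obtain ⟨hmW, hmT⟩ := Finset.mem_sdiff.1 hm
  rw [bornPair_coeff_bornTrialPoly_pairIndex γ L N J₁ (Finset.insert_subset hmW hT),
    Finset.card_insert_of_notMem hmT, Finset.prod_insert hmT]
  simp only [Nat.succ_le_iff]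

/-- The pair term `p = m`, `m ∈ W₊ ∖ T`, of the coefficient of `Q A` at `E_T`: the amplitude of the
sector `T ∪ {m}` (unit combinatorial factors). [folklore] -/
theorem bornPair_term_pair (γ L : ℝ) {M R : ℕ} (N J₁ : ℕ) {T : Finset Momentum}
    (hT : T ⊆ pairReps M R) {m : Momentum} (hm : m ∈ pairReps M R \ T) :
    coeff (pairIndex M (N - 2) T + Finsupp.single (toBand M (-m)) 1 +
          Finsupp.single (toBand M m) 1) (bornTrialPoly γ L M R N J₁) *
        ((((pairIndex M (N - 2) T) (toBand M m) + Finsupp.single (toBand M (-m)) 1 (toBand M m)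
            + 1) * ((pairIndex M (N - 2) T) (toBand M (-m)) + 1) : ℕ) : ℂ) =
      if T.card < J₁ then
        (((bornCoeff γ L M R N (T.card + 1) * (modeWeight L m * ∏ m' ∈ T, modeWeight L m') : ℝ))
          : ℂ) else 0 := by
  obtain ⟨hmW, hmT⟩ := Finset.mem_sdiff.1 hm
  obtain ⟨-, hmB, hmB', hmn⟩ := bornPair_mem_pairReps hmW
  have hne : -m ≠ m := fun h => hmn (by rw [h]; exact hmW)
  rw [bornPair_pairIndex_insert hmT, bornPair_coeff_insert γ L N J₁ hT hm,
    BornPolyNorms.pairIndex_apply_rep hT hmW, bornPair_pairIndex_apply_neg hT hmW, if_neg hmT,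
    bornPair_single_apply hmB' hmB, if_neg hne]
  simp

/-- The pair term `p = −m`, `m ∈ W₊ ∖ T`, of the coefficient of `Q A` at `E_T`: again the amplitude
of the sector `T ∪ {m}` (the interference factor `2`). [folklore] -/
theorem bornPair_term_pair_neg (γ L : ℝ) {M R : ℕ} (N J₁ : ℕ) {T : Finset Momentum}
    (hT : T ⊆ pairReps M R) {m : Momentum} (hm : m ∈ pairReps M R \ T) :
    coeff (pairIndex M (N - 2) T + Finsupp.single (toBand M (- -m)) 1 +
          Finsupp.single (toBand M (-m)) 1) (bornTrialPoly γ L M R N J₁) *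
        ((((pairIndex M (N - 2) T) (toBand M (-m)) +
            Finsupp.single (toBand M (- -m)) 1 (toBand M (-m)) + 1) *
            ((pairIndex M (N - 2) T) (toBand M (- -m)) + 1) : ℕ) : ℂ) =
      if T.card < J₁ then
        (((bornCoeff γ L M R N (T.card + 1) * (modeWeight L m * ∏ m' ∈ T, modeWeight L m') : ℝ))
          : ℂ) else 0 := by
  obtain ⟨hmW, hmT⟩ := Finset.mem_sdiff.1 hm
  obtain ⟨-, hmB, hmB', hmn⟩ := bornPair_mem_pairReps hmW
  have hne : m ≠ -m := fun h => hmn (by rw [← h]; exact hmW)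
  rw [neg_neg, add_right_comm (pairIndex M (N - 2) T), bornPair_pairIndex_insert hmT,
    bornPair_coeff_insert γ L N J₁ hT hm, BornPolyNorms.pairIndex_apply_rep hT hmW,
    bornPair_pairIndex_apply_neg hT hmW, if_neg hmT, bornPair_single_apply hmB hmB', if_neg hne]
  simp

/-- The condensate term `p = 0` of the coefficient of `Q A` at `E_T`: the amplitude of the sector `T`
itself times `(N − 2j)(N − 2j − 1)`. [folklore] -/
theorem bornPair_term_zero (γ L : ℝ) {M R : ℕ} (N J₁ : ℕ) {T : Finset Momentum}
    (hT : T ⊆ pairReps M R) (hTJ : T.card ≤ J₁) (hj2 : 2 * T.card + 2 ≤ N) :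
    coeff (pairIndex M (N - 2) T + Finsupp.single (toBand M (-0)) 1 +
          Finsupp.single (toBand M 0) 1) (bornTrialPoly γ L M R N J₁) *
        ((((pairIndex M (N - 2) T) (toBand M 0) + Finsupp.single (toBand M (-0)) 1 (toBand M 0)
            + 1) * ((pairIndex M (N - 2) T) (toBand M (-0)) + 1) : ℕ) : ℂ) =
      (((bornCoeff γ L M R N T.card * ∏ m ∈ T, modeWeight L m : ℝ)) : ℂ) *
        ((((N : ℝ) - 2 * T.card) * ((N : ℝ) - 2 * T.card - 1) : ℝ) : ℂ) := by
  have hc : ((N - 2 - 2 * T.card : ℕ) : ℂ) = (N : ℂ) - 2 * (T.card : ℂ) - 2 := by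
    rw [Nat.cast_sub (by omega), Nat.cast_sub (by omega)]
    push_cast
    ring
  rw [neg_zero, bornPair_pairIndex_add_two hj2, bornPair_coeff_bornTrialPoly_pairIndex γ L N J₁ hT,
    if_pos hTJ, BornPolyNorms.pairIndex_apply_zero hT, Finsupp.single_eq_same]
  push_cast
  rw [hc]
  ring

/-- **Registered auxiliary stub** `stub_bornPolyPairCoeff`: the coefficient of
`Q A = Σ_{p ∈ B_M} ∂_{−p}∂_p A`, `A` the Born trial polynomial, at the index `E_T` of the sector
`T ⊆ W₊`, `|T| = j ≤ J₁`, with `N − 2` particles is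
`λ_j θ^T (N−2j)(N−2j−1) · (1 − [j < J₁] · 2c Σ_{m ∈ W₊ ∖ T} θ_m)`: the condensate term `∂₀²` of the
sector `(j, T)` interferes with the pair terms `∂_{∓m}∂_{±m}` of the sectors `(j+1, T ∪ {m})`, whose
amplitudes are `λ_{j+1} θ_m θ^T = −c (N−2j)(N−2j−1) λ_j θ_m θ^T` — the second-Born renormalisation
realised by a number-conserving state. [folklore] -/
theorem stub_bornPolyPairCoeff :
    ∀ (γ L : ℝ) (M R N J₁ : ℕ) (T : Finset Momentum), 2 * J₁ + 2 ≤ N → T ⊆ pairReps M R →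
      T.card ≤ J₁ →
      MvPolynomial.coeff (pairIndex M (N - 2) T)
          (∑ p : ↥(momentumBand M), MvPolynomial.pderiv (-p)
            (MvPolynomial.pderiv p (bornTrialPoly γ L M R N J₁))) =
        ((bornCoeff γ L M R N T.card * (∏ m ∈ T, modeWeight L m) *
            (((N : ℝ) - 2 * T.card) * ((N : ℝ) - 2 * T.card - 1)) *
            (1 - if T.card < J₁ then
              2 * bornCoupling γ L M R * ∑ m ∈ pairReps M R \ T, modeWeight L m else 0) : ℝ) :
          ℂ) := by
  intro γ L M R N J₁ T hN hT hTJ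
  have hj2 : 2 * T.card + 2 ≤ N := by omega
  rw [bornPair_coeff_pairAn_sum, bornPair_sum_band_split (Finset.sdiff_subset (t := T)) _
    fun k hk hk0 hk1 hk2 => by rw [bornPair_coeff_shift_eq_zero γ L N J₁ hT hk hk0 hk1 hk2, zero_mul],
    bornPair_term_zero γ L N J₁ hT hTJ hj2, Finset.sum_congr rfl fun m hm => by
      rw [bornPair_term_pair γ L N J₁ hT hm, bornPair_term_pair_neg γ L N J₁ hT hm]]
  set c := bornCoupling γ L M R
  set lam := bornCoeff γ L M R N T.card
  set th := ∏ m' ∈ T, modeWeight L m'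
  set P := ((N : ℝ) - 2 * T.card) * ((N : ℝ) - 2 * T.card - 1)
  set U := pairReps M R \ T
  by_cases hlt : T.card < J₁
  · have hrec : bornCoeff γ L M R N (T.card + 1) = -c * P * lam :=
      bornPair_bornCoeff_succ γ L M R hj2
    simp only [if_pos hlt]
    have hS : ∑ m ∈ U, ((((bornCoeff γ L M R N (T.card + 1) * (modeWeight L m * th) : ℝ)) : ℂ) +
        (((bornCoeff γ L M R N (T.card + 1) * (modeWeight L m * th) : ℝ)) : ℂ)) =
        ((2 * (-c * P * lam) * th : ℝ) : ℂ) * ∑ m ∈ U, ((modeWeight L m : ℝ) : ℂ) := by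
      rw [Finset.mul_sum]
      refine Finset.sum_congr rfl fun m _ => ?_
      rw [hrec]
      push_cast
      ring
    rw [hS]
    push_cast
    ring
  · simp only [if_neg hlt, add_zero, Finset.sum_const_zero, sub_zero]
    push_cast
    ring

end Summit.AtomisticToContinuum.BoseEinsteinCondensation.Cruxes.RichardsonAnchorBEC.Birth

end
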